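import Mathlib
import HarnessLib
import Summits.QuantumFields.YangMills.Theorems.MirrorModularBoostsHypercubicLimitPlaneDistTensor
import Literature.MathematicalPhysics.QuantumLattice.SchwartzReIm
import Literature.MathematicalPhysics.QuantumLattice.SchwartzTensor

/-!
# Line `Sketch` (coupling response): the plane-string distributions on slot-disjoint complex products

Helper file for crux `stmt-QuantumFields-16154` (`HypercubicLimit`), line `Sketch`, sub-goal
`planeDist_disjointProductBound` (Z1b, the model side of the step "smeared → functional"): the line's UV input
`UniformMomentBoundsPlanes r sch` (`k`-uniform bounds `C₀ C₁ⁿ n!` on the Wilson moments of products of anisotropically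
smeared fields on normalised, pairwise plane-wise disjoint families of 6-tuples of REAL tests) is converted into the
hypothesis shape consumed by the model-free extension theorem: a bound
`‖planeDist r sch k n q F‖ ≤ C₀' C₁'ⁿ n! ∏ᵢ |φᵢ|_s` for every plane string `q`, every step `k` and every tensor
`F = φ₁ ⊗ ⋯ ⊗ φₙ` of COMPLEX one-point tests with pairwise disjoint supports.

Proof.  (1) Real products: by `planeDist_eq_integral_prod_planeField`, on `⊗ᵢ fᵢ` (real `fᵢ`) the distribution is
`∫ ∏ᵢ Φ^{qᵢ}_k(fᵢ) dμ_k`; each plane field `Φ^{qᵢ}_k(fᵢ)` is the anisotropic field `Φ^P_k` of the single-plane tuple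
`Pi.single qᵢ fᵢ`, and after normalising by `Nᵢ = |fᵢ|_s` (homogeneity `fieldP_smul`) the moment bound gives
`|∫ ∏ᵢ Φ^{qᵢ}_k(fᵢ)| ≤ |C₀| |C₁|ⁿ n! ∏ᵢ Nᵢ` (a vanishing `Nᵢ` forces `fᵢ = 0` and both sides vanish).
(2) Complex products: `φ₁ ⊗ ⋯ ⊗ φₙ = Σ_{t ⊆ [n]} i^{n−|t|} ⊗ᵢ ψᵗᵢ` with `ψᵗᵢ ∈ {re φᵢ, im φᵢ}`
(`eq_sum_tensorFin_reIm`): `2ⁿ` real disjoint products, each bounded by (1) and `|re φ|_s, |im φ|_s ≤ |φ|_s`;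
whence `C₀' = |C₀|`, `C₁' = 2|C₁|`.
References: Glimm–Jaffe 1987 §6.1; Osterwalder–Schrader 1973 §2, 1975 §2.
-/

noncomputable section

open scoped SchwartzMap
open MeasureTheory Filter Topology
open Literature.MathematicalPhysics.AQFT Literature.MathematicalPhysics.QuantumLattice
open Literature.MathematicalPhysics.QuantumFieldTheory

namespace Summit.QuantumFields.YangMills.Cruxes.HypercubicLimit.CouplingResponse

section Tuples

/-- The total Schwartz norm is absolutely homogeneous: `normP s (c • f) = |c| normP s f`. [folklore] -/
theorem normP_smul (s : ℕ) (c : ℝ) (f : Plane → 𝓢(EuclideanSpace ℝ (Fin 4), ℝ)) :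
    normP s (c • f) = |c| * normP s f := by
  unfold normP
  rw [Finset.mul_sum]
  refine Finset.sum_congr rfl fun p _ => ?_
  rw [Pi.smul_apply, schwartzNorm_ofRealTest_smul]

/-- The total Schwartz norm of a tuple supported on one plane is the norm of its only component. [folklore] -/
theorem normP_single (s : ℕ) (p : Plane) (f : 𝓢(EuclideanSpace ℝ (Fin 4), ℝ)) :
    normP s (Pi.single p f) = schwartzNorm s (ofRealTest f) := by
  unfold normP
  rw [Finset.sum_eq_single p]
  · rw [Pi.single_eq_same]
  · intro p' _ hp'
    rw [Pi.single_eq_of_ne hp', map_zero]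
    exact map_zero ((Finset.Iic (s, s)).sup (schwartzSeminormFamily ℂ (EuclideanSpace ℝ (Fin 4)) ℂ))
  · exact fun h => absurd (Finset.mem_univ p) h

/-- Every component of a scaled single-plane tuple is supported inside the support of the test function. [folklore] -/
theorem tsupport_smul_single_subset (c : ℝ) (p p' : Plane) (f : 𝓢(EuclideanSpace ℝ (Fin 4), ℝ)) :
    tsupport (((c • Pi.single p f : Plane → 𝓢(EuclideanSpace ℝ (Fin 4), ℝ)) p' :
        𝓢(EuclideanSpace ℝ (Fin 4), ℝ)) : EuclideanSpace ℝ (Fin 4) → ℝ) ⊆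
      tsupport (f : EuclideanSpace ℝ (Fin 4) → ℝ) := by
  rw [Pi.smul_apply, FunLike.coe_smul]
  refine (tsupport_smul_subset_right (fun _ : EuclideanSpace ℝ (Fin 4) => c) _).trans ?_
  by_cases h : p' = p
  · subst h
    rw [Pi.single_eq_same]
  · rw [Pi.single_eq_of_ne h, FunLike.coe_zero, tsupport_zero]
    exact Set.empty_subset _

end Tuples

section Real

variable {G : Type} [Group G] [TopologicalSpace G] [IsTopologicalGroup G] [CompactSpace G]
  [MeasurableSpace G] [BorelSpace G]

/-- The plane field of the zero test function vanishes. [folklore] -/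
theorem planeField_zero (r : LatticeRep G) (sch : SpeciesScheme (YMSpecies G)) (k : ℕ) (p : Plane)
    (U : GaugeConfig 4 (sch.side k) G) : planeField r sch k p 0 U = 0 := by
  unfold planeField smearedLatticeField
  simp

/-- The anisotropic field of a tuple supported on one plane is that plane's field. [folklore] -/
theorem fieldP_single (r : LatticeRep G) (sch : SpeciesScheme (YMSpecies G)) (k : ℕ) (p : Plane)
    (f : 𝓢(EuclideanSpace ℝ (Fin 4), ℝ)) (U : GaugeConfig 4 (sch.side k) G) :
    fieldP r sch k (Pi.single p f) U = planeField r sch k p f U := by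
  unfold fieldP
  rw [Finset.sum_eq_single p]
  · rw [Pi.single_eq_same]
  · intro p' _ hp'
    rw [Pi.single_eq_of_ne hp', planeField_zero]
  · exact fun h => absurd (Finset.mem_univ p) h

/-- **Step 1 (real disjoint products).**  If the anisotropic moments obey the `UniformMomentBoundsPlanes`
estimate with index `s` and constants `C₀, C₁`, then for every plane string `q`, every step `k` and every family
of real tests `fᵢ` with pairwise disjoint supports, `|∫ ∏ᵢ Φ^{qᵢ}_k(fᵢ) dμ_k| ≤ |C₀| |C₁|ⁿ n! ∏ᵢ |fᵢ|_s`
(single-plane tuples `Pi.single qᵢ fᵢ`, normalised by homogeneity). [folklore] -/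
theorem abs_integral_prod_planeField_le (r : LatticeRep G) (sch : SpeciesScheme (YMSpecies G)) {s : ℕ}
    {C₀ C₁ : ℝ}
    (hU : ∀ (n : ℕ) (F : Fin n → Plane → 𝓢(EuclideanSpace ℝ (Fin 4), ℝ)), (∀ i, normP s (F i) ≤ 1) →
      (∀ i j, i ≠ j → DisjP (F i) (F j)) →
        ∀ k : ℕ, |∫ U, ∏ i, fieldP r sch k (F i) U ∂(wilsonAt r sch k)| ≤ C₀ * C₁ ^ n * n.factorial)
    (k n : ℕ) (q : Fin n → Plane) (f : Fin n → 𝓢(EuclideanSpace ℝ (Fin 4), ℝ))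
    (hdisj : ∀ i j, i ≠ j →
      Disjoint (tsupport (f i : EuclideanSpace ℝ (Fin 4) → ℝ)) (tsupport (f j : EuclideanSpace ℝ (Fin 4) → ℝ))) :
    |∫ U, ∏ i, planeField r sch k (q i) (f i) U ∂(wilsonAt r sch k)| ≤
      |C₀| * |C₁| ^ n * n.factorial * ∏ i, schwartzNorm s (ofRealTest (f i)) := by
  -- the bound of `hU` dominated by its absolute version
  have hCC : C₀ * C₁ ^ n * (n.factorial : ℝ) ≤ |C₀| * |C₁| ^ n * n.factorial := by
    rw [← abs_pow, ← abs_mul]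
    exact mul_le_mul_of_nonneg_right (le_abs_self _) (Nat.cast_nonneg _)
  set N : Fin n → ℝ := fun i => schwartzNorm s (ofRealTest (f i)) with hN
  have hN0 : ∀ i, 0 ≤ N i := fun i => schwartzNorm_nonneg _ _
  by_cases hz : ∃ i, N i = 0
  · -- a factor with vanishing norm vanishes, and so do both sides
    obtain ⟨i₀, hi₀⟩ := hz
    have hf : f i₀ = 0 := eq_zero_of_schwartzNorm_ofRealTest_eq_zero hi₀
    have hprod : (fun U => ∏ i, planeField r sch k (q i) (f i) U) = fun _ => 0 := funext fun U =>
      Finset.prod_eq_zero (Finset.mem_univ i₀) (by rw [hf, planeField_zero])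
    have hrhs : ∏ i, N i = 0 := Finset.prod_eq_zero (Finset.mem_univ i₀) hi₀
    rw [hprod, integral_zero, abs_zero, hrhs, mul_zero]
  · push Not at hz
    have hpos : ∀ i, 0 < N i := fun i => lt_of_le_of_ne (hN0 i) (hz i).symm
    -- the normalised single-plane tuples
    set Fi : Fin n → Plane → 𝓢(EuclideanSpace ℝ (Fin 4), ℝ) := fun i => (N i)⁻¹ • Pi.single (q i) (f i)
      with hFi
    have hfield : ∀ i U, fieldP r sch k (Fi i) U = (N i)⁻¹ * planeField r sch k (q i) (f i) U :=
      fun i U => by rw [hFi, fieldP_smul, fieldP_single]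
    have hnorm : ∀ i, normP s (Fi i) ≤ 1 := fun i => by
      rw [hFi, normP_smul, normP_single, abs_of_pos (inv_pos.2 (hpos i))]
      exact (inv_mul_cancel₀ (hpos i).ne').le
    have hdisjP : ∀ i j, i ≠ j → DisjP (Fi i) (Fi j) := fun i j hij p p' =>
      (hdisj i j hij).mono (tsupport_smul_single_subset _ _ _ _) (tsupport_smul_single_subset _ _ _ _)
    have hkey : (fun U => ∏ i, planeField r sch k (q i) (f i) U) =
        fun U => (∏ i, N i) * ∏ i, fieldP r sch k (Fi i) U := funext fun U => by
      rw [← Finset.prod_mul_distrib]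
      refine Finset.prod_congr rfl fun i _ => ?_
      rw [hfield, ← mul_assoc, mul_inv_cancel₀ (hpos i).ne', one_mul]
    have hPN : 0 ≤ ∏ i, N i := Finset.prod_nonneg fun i _ => hN0 i
    rw [hkey, integral_const_mul, abs_mul, abs_of_nonneg hPN]
    calc (∏ i, N i) * |∫ U, ∏ i, fieldP r sch k (Fi i) U ∂(wilsonAt r sch k)|
        ≤ (∏ i, N i) * (|C₀| * |C₁| ^ n * n.factorial) :=
          mul_le_mul_of_nonneg_left ((hU n Fi hnorm hdisjP k).trans hCC) hPN
      _ = |C₀| * |C₁| ^ n * n.factorial * ∏ i, N i := by ring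

end Real

/-- **Registered sub-goal `planeDist_disjointProductBound` (line `Sketch`, Z1b: the model side of the step
"smeared → functional").**  The `k`-uniform plane-resolved moment bounds `UniformMomentBoundsPlanes r sch` imply,
for one Schwartz index `s` and constants `C₀', C₁' ≥ 0`, the bound
`‖planeDist r sch k n q F‖ ≤ C₀' C₁'ⁿ n! ∏ᵢ |φᵢ|_s` for every step `k`, every plane string `q` and every tensor
`F = φ₁ ⊗ ⋯ ⊗ φₙ` of complex one-point tests with pairwise disjoint supports (`C₀' = |C₀|`, `C₁' = 2|C₁|`: `2ⁿ` real
disjoint products `⊗ᵢ ψᵗᵢ`, `ψᵗᵢ ∈ {re φᵢ, im φᵢ}`). [folklore] -/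
theorem planeDist_disjointProductBound : ∀ (G : Type) [Group G] [TopologicalSpace G] [IsTopologicalGroup G] [CompactSpace G] [MeasurableSpace G] [BorelSpace G] (r : LatticeRep G) (sch : SpeciesScheme (YMSpecies G)), UniformMomentBoundsPlanes r sch → ∃ (s : ℕ) (C₀ C₁ : ℝ), 0 ≤ C₀ ∧ 0 ≤ C₁ ∧ ∀ (k n : ℕ) (q : Fin n → Plane) (φ : Fin n → 𝓢(EuclideanSpace ℝ (Fin 4), ℂ)), (∀ i j, i ≠ j → Disjoint (tsupport (φ i : EuclideanSpace ℝ (Fin 4) → ℂ)) (tsupport (φ j : EuclideanSpace ℝ (Fin 4) → ℂ))) → ∀ F : 𝓢((Fin n → EuclideanSpace ℝ (Fin 4)), ℂ), IsTensorOf F φ → ‖planeDist r sch k n q F‖ ≤ C₀ * C₁ ^ n * (n.factorial : ℝ) * ∏ i, schwartzNorm s (φ i) := by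
  intro G _ _ _ _ _ _ r sch hUMB
  obtain ⟨s, C₀, C₁, hU⟩ := hUMB
  refine ⟨s, |C₀|, 2 * |C₁|, abs_nonneg _, by positivity, ?_⟩
  intro k n q φ hdisj F hF
  -- the `2ⁿ` families of real and imaginary parts
  set ψ : Finset (Fin n) → Fin n → 𝓢(EuclideanSpace ℝ (Fin 4), ℝ) :=
    fun t i => if i ∈ t then reTest (φ i) else imTest (φ i) with hψ
  have hψsupp : ∀ t i, tsupport (ψ t i : EuclideanSpace ℝ (Fin 4) → ℝ) ⊆
      tsupport (φ i : EuclideanSpace ℝ (Fin 4) → ℂ) := fun t i => by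
    rw [hψ]
    dsimp only
    split_ifs
    · exact tsupport_reTest_subset _
    · exact tsupport_imTest_subset _
  have hψnorm : ∀ t i, schwartzNorm s (ofRealTest (ψ t i)) ≤ schwartzNorm s (φ i) := fun t i => by
    rw [hψ]
    dsimp only
    split_ifs
    · exact schwartzNorm_ofRealTest_reTest_le _ _
    · exact schwartzNorm_ofRealTest_imTest_le _ _
  have hψdisj : ∀ t i j, i ≠ j → Disjoint (tsupport (ψ t i : EuclideanSpace ℝ (Fin 4) → ℝ))
      (tsupport (ψ t j : EuclideanSpace ℝ (Fin 4) → ℝ)) := fun t i j hij =>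
    (hdisj i j hij).mono (hψsupp t i) (hψsupp t j)
  -- each real summand is a Wilson moment, bounded by Step 1 and `|re φ|_s, |im φ|_s ≤ |φ|_s`
  have hterm : ∀ t : Finset (Fin n),
      ‖planeDist r sch k n q (SchwartzMap.tensorFin n (fun i => ofRealTest (ψ t i)))‖ ≤
        |C₀| * |C₁| ^ n * n.factorial * ∏ i, schwartzNorm s (φ i) := fun t => by
    rw [planeDist_eq_integral_prod_planeField G r sch k n q (ψ t) _ (isTensorOf_tensorFin _),
      Complex.norm_real, Real.norm_eq_abs]
    refine (abs_integral_prod_planeField_le r sch hU k n q (ψ t) (hψdisj t)).trans ?_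
    exact mul_le_mul_of_nonneg_left
      (Finset.prod_le_prod (fun i _ => schwartzNorm_nonneg _ _) fun i _ => hψnorm t i) (by positivity)
  -- sum over the `2ⁿ` summands of `eq_sum_tensorFin_reIm`
  rw [eq_sum_tensorFin_reIm φ F hF, map_sum]
  refine (norm_sum_le _ _).trans ?_
  calc ∑ t : Finset (Fin n), ‖planeDist r sch k n q ((Complex.I ^ (n - t.card)) •
          SchwartzMap.tensorFin n (fun i => ofRealTest (ψ t i)))‖
      ≤ ∑ _t : Finset (Fin n), |C₀| * |C₁| ^ n * n.factorial * ∏ i, schwartzNorm s (φ i) := by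
        refine Finset.sum_le_sum fun t _ => ?_
        rw [map_smul, norm_smul, norm_pow, Complex.norm_I, one_pow, one_mul]
        exact hterm t
    _ = |C₀| * (2 * |C₁|) ^ n * n.factorial * ∏ i, schwartzNorm s (φ i) := by
        rw [Finset.sum_const, Finset.card_univ, Fintype.card_finset, Fintype.card_fin, nsmul_eq_mul,
          mul_pow]
        push_cast
        ring

end Summit.QuantumFields.YangMills.Cruxes.HypercubicLimit.CouplingResponse

end
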